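import Summits.AtomisticToContinuum.Crystallization.Theorems.DisclinationRationUniformPolytypeStabilityDefs
import Summits.AtomisticToContinuum.Crystallization.Theorems.DisclinationRationUniformPolytypeStabilitySites
import Summits.AtomisticToContinuum.Crystallization.Theorems.DisclinationRationUniformPolytypeStabilityPairSum
import Summits.AtomisticToContinuum.Crystallization.Theorems.DisclinationRationUniformPolytypeStabilityNearCells
import Summits.AtomisticToContinuum.Crystallization.Theorems.DisclinationRationUniformPolytypeStabilityNull
import Summits.AtomisticToContinuum.Crystallization.Theorems.DisclinationRationUniformPolytypeStabilityGapPinning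
import Summits.AtomisticToContinuum.Crystallization.Theorems.DisclinationRationUniformPolytypeStabilityFarDefs

/-!
# Skeleton v3 ("cells", far field reshaped) — crux `UniformPolytypeStability` (stmt-AtomisticToContinuum-15800), line `birth`

v3: the load-bearing stub `stub_farNear` of v2 is DECOMPOSED (vocabulary `…FarChains.lean` p173179, `…FarDefs.lean` p173350):
* `stub_allChecked` (XS, computational) — `allChecked R₃ = true`: every class of the far table passes the rational chain checks
  (`native_decide`, ≈3 min at `R₃ = 8`; lands with the parameter module `…FarParams.lean`).
* `stub_chainIdentity` (L) — `∀ Δm 3q, ChainIdentityAt Δm 3q`: soundness of the checker (affine interpolants telescope).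
* `stub_planeChainIdentity` (M) — `∀ q, PlaneChainIdentityAt q`.
* `stub_pairCharge` (M) — `∀ η > 0, PairChargeBound η`: sign of `V″`, chain identity, `e = Δm d_l + δ_l e₃`, Cauchy–Schwarz.
* `stub_farCensus` (M/L) — `∀ R ≥ 2, FarCensus R`: the ordered far pairs = steep table pairs (×2) + in-plane table pairs + rest (`r > R`).
* `stub_farRegroup` (M/L) — `∀ R η, FarRegroup R η`: translate-sum of pair charges into `Σ_cells cellFarCharge`.
* `stub_farTail` (L) — `FarTail R₃ K`: nearest-neighbour paths + lattice counting for `r > R₃`.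
* `stub_cellCert` (XL, computational) — `CellCertificate κ R₃ η Ccoef`: 24×24 PSD over the pinned `(a, h̄)` sheet per 7-letter window.
* `stub_farNear` (registered v2 signature) is now the sorry-free ASSEMBLY `farNear_of` below applied to the eight stubs.
The parameter values `R₃ η K κ Ccoef` below are PLACEHOLDERS until `num/FARCHAIN-REPORT.md` fixes them (then they move to
a landed `…FarParams.lean` and the three parameter-dependent stubs are registered).
-/

noncomputable section

namespace Summit.AtomisticToContinuum.Crystallization.Theorems.UniformPolytypeStabilityCells

open scoped BigOperators Topology InnerProductSpace
open Filter Set Function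
open Literature.MathematicalPhysics.StatisticalMechanics
open Summit.AtomisticToContinuum.Crystallization.Theorems.PhononStabilityNegative (Hess₀)
open FarChain

/-- Euclidean `3`-space. -/
local notation "E3" => EuclideanSpace ℝ (Fin 3)

/-! ### Parameters (PLACEHOLDERS) -/

/-- far-table range -/
def R₃ : ℚ := 8
/-- Cauchy–Schwarz splitting parameter of the leak term -/
def ηpar : ℝ := 1 / 10
/-- tail constant: pairs beyond `R₃` cost `Ktail/R₃³` in nearest-neighbour currency -/
def Ktail : ℚ := 10
/-- certified cell constant -/
def κcert : ℝ := 1 / 25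
/-- null-Lagrangian coefficients as a function of `(a, h̄)` (placeholder) -/
def Ccoef : ℝ → ℝ → (Fin 3 × Fin 3 → Fin 3 × Fin 3 → ℝ) := fun _ _ _ _ => 0

/-- all table classes of range `R` pass the chain checks -/
def allChecked (R : ℚ) : Bool :=
  (steepClasses R).all (fun c => checkSteep c.1 c.2) && (planeClasses R).all checkPlane

/-! ### Stubs of v3 -/

/-- STUB (XS, computational) — the far table of range `R₃` passes all chain checks. -/
theorem stub_allChecked : allChecked R₃ = true := by
  sorry

/-- STUB (L) — soundness of the steep chain checker. -/
theorem stub_chainIdentity : ∀ (dm : ℕ) (q3 : ℤ × ℤ), ChainIdentityAt dm q3 := by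
  sorry

/-- STUB (M) — soundness of the in-plane chain checker. -/
theorem stub_planeChainIdentity : ∀ q : ℤ × ℤ, PlaneChainIdentityAt q := by
  sorry

/-- STUB (M) — per-pair charge bound. -/
theorem stub_pairCharge : ∀ η : ℝ, 0 < η → PairChargeBound η := by
  sorry

/-- STUB (M/L) — census of the far pairs. -/
theorem stub_farCensus : ∀ R : ℚ, 2 ≤ R → FarCensus R := by
  sorry

/-- STUB (M/L) — translate-sum regrouping of the pair charges into cell charges. -/
theorem stub_farRegroup : ∀ (R : ℚ) (η : ℝ), FarRegroup R η := by
  sorry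

/-- STUB (L) — the far tail in nearest-neighbour currency. -/
theorem stub_farTail : FarTail R₃ Ktail := by
  sorry

/-- STUB (XL, computational) — the cell certificate. -/
theorem stub_cellCert : CellCertificate κcert R₃ ηpar Ccoef := by
  sorry

/-! ### Assembly (sorry-free) -/

/-- Members of the steep table satisfy the table predicate. -/
theorem inSteepTableB_of_mem {R : ℚ} {c : ℕ × ℤ × ℤ} (hc : c ∈ steepClasses R) : inSteepTableB R c.1 c.2 = true := by
  unfold steepClasses at hc
  simp only [List.mem_flatten, List.mem_map] at hc
  obtain ⟨l, ⟨dm, -, rfl⟩, hc⟩ := hc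
  simp only [List.mem_flatten, List.mem_map] at hc
  obtain ⟨l', ⟨A, -, rfl⟩, hc⟩ := hc
  simp only [List.mem_map, List.mem_filter] at hc
  obtain ⟨B, ⟨-, hB⟩, rfl⟩ := hc
  exact hB

/-- Members of the in-plane table satisfy the table predicate. -/
theorem inPlaneTableB_of_mem {R : ℚ} {q : ℤ × ℤ} (hq : q ∈ planeClasses R) : inPlaneTableB R q = true := by
  unfold planeClasses at hq
  simp only [List.mem_flatten, List.mem_map] at hq
  obtain ⟨l, ⟨A, -, rfl⟩, hq⟩ := hq
  simp only [List.mem_map, List.mem_filter] at hq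
  obtain ⟨B, ⟨-, hB⟩, rfl⟩ := hq
  exact hB

/-- THE ASSEMBLY: the eight v3 stubs give the registered v2 stub `stub_farNear`
`(box → NullFactsAt) → ∃ κ₁ > 0, FarNearAt κ₁` with `κ₁ = κ − K/R³`. -/
theorem farNear_of {R K : ℚ} {η κ : ℝ} {C : ℝ → ℝ → (Fin 3 × Fin 3 → Fin 3 × Fin 3 → ℝ)}
    (hR : 2 ≤ R) (hη : 0 < η) (hκ : (K : ℝ) / (R : ℝ) ^ 3 < κ)
    (hall : allChecked R = true)
    (hCI : ∀ (dm : ℕ) (q3 : ℤ × ℤ), ChainIdentityAt dm q3) (hPI : ∀ q : ℤ × ℤ, PlaneChainIdentityAt q)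
    (hPC : ∀ η : ℝ, 0 < η → PairChargeBound η) (hFC : ∀ R : ℚ, 2 ≤ R → FarCensus R)
    (hFR : ∀ (R : ℚ) (η : ℝ), FarRegroup R η) (hFT : FarTail R K) (hCC : CellCertificate κ R η C)
    (hNull : ∀ (a : ℝ) (s : ℤ → ℤ) (z : ℤ → ℝ), 47 / 50 ≤ a → a ≤ 1 → IsHaggSeq s → HeightBox a z →
      NullFactsAt a s z) :
    ∃ κ₁ : ℝ, 0 < κ₁ ∧ FarNearAt κ₁ := by
  refine ⟨κ - (K : ℝ) / (R : ℝ) ^ 3, by linarith, ?_⟩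
  intro a s z ha ha' hs hbox hpin hS U hU hsumH
  -- checks from the table
  have hchk : ∀ c ∈ steepClasses R, checkSteep c.1 c.2 = true := by
    have h := hall; unfold allChecked at h
    simp only [Bool.and_eq_true, List.all_eq_true] at h
    exact fun c hc => h.1 c hc
  have hchkP : ∀ q ∈ planeClasses R, checkPlane q = true := by
    have h := hall; unfold allChecked at h
    simp only [Bool.and_eq_true, List.all_eq_true] at h
    exact fun q hq => h.2 q hq
  -- near cells: finiteness of the cell families and summability of the near terms
  obtain ⟨hfinH, hfinN, hsumNear, -, -, -⟩ := stub_nearCells a s z ha ha' hs hbox hS U hU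
  have hsumFar : Summable (farTerm a s z U) := by
    have heq : farTerm a s z U = fun xy => hessTerm a s z U xy - nearTerm a s z U xy := by
      funext xy
      unfold hessTerm nearTerm farTerm
      by_cases h1 : xy.1 = xy.2
      · simp [h1]
      · by_cases h2 : NearPair s xy.1 xy.2 <;> simp [h1, h2]
    rw [heq]; exact hsumH.sub hsumNear
  -- census
  obtain ⟨rest, hrest, hrestfar, hsumS, hsumP, hsplit⟩ := hFC R hR a s z ha ha' hs hbox hS U hU hsumFar
  -- pair charges
  obtain ⟨hsteep, hplane⟩ := hPC η hη hCI hPI a s z ha ha' hs hbox hpin hS U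
  -- regrouping
  obtain ⟨hfinFar, hsumCS, hsumCP, hregroup⟩ := hFR R η a s z ha ha' hs hbox U hU
  -- tail
  have htail := hFT a s z ha ha' hs hbox hS U hU rest hrest hrestfar
  -- null Lagrangian
  obtain ⟨hfinNull, hnull⟩ := hNull a s z ha ha' hs hbox (C a (gap z 0)) U hU
  -- (1) steep table terms dominate minus the steep charges
  have h1 : -(∑' t : (ℕ × ℤ × ℤ) × (ℤ × ℤ × ℤ),
      (if t.1 ∈ steepClasses R ∧ Realized s t.2.1 t.1.1 t.1.2 then
        classWt a z t.2.1 t.1.1 t.1.2 *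
          ∑ l ∈ Finset.range t.1.1, ((slabPieces t.1.1 t.1.2 l (reg3 s t.2.1 l) (letterB s (t.2.1 + l))).map fun p =>
            ((p.s1 - p.s0 : ℚ) : ℝ) *
              ((1 + η) * (t.1.1 : ℝ) ^ 3 *
                  tetStrain a s z U (pieceCell s t.2.1 t.2.2.1 t.2.2.2 l p) p.tet (dirReal a s z (t.2.1 + l) t.1.1 t.1.2) ^ 2 +
                (1 + η⁻¹) * (t.1.1 : ℝ) * heightDefect z t.2.1 t.1.1 (t.2.1 + l) ^ 2 *
                  tetLeak a s z U (pieceCell s t.2.1 t.2.2.1 t.2.2.2 l p) p.tet (dirReal a s z (t.2.1 + l) t.1.1 t.1.2) ^ 2)).sum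
      else 0)) ≤
      ∑' t : (ℕ × ℤ × ℤ) × (ℤ × ℤ × ℤ),
        (if t.1 ∈ steepClasses R ∧ Realized s t.2.1 t.1.1 t.1.2 then
          farTerm a s z U (t.2, topSite s t.2.1 t.2.2.1 t.2.2.2 t.1.1 t.1.2) else 0) := by
    rw [← tsum_neg]
    refine Summable.tsum_le_tsum (fun t => ?_) hsumCS.neg hsumS
    by_cases ht : t.1 ∈ steepClasses R ∧ Realized s t.2.1 t.1.1 t.1.2
    · rw [if_pos ht, if_pos ht]
      have htab := inSteepTableB_of_mem ht.1
      have hdm : 0 < t.1.1 := by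
        unfold inSteepTableB at htab; simp only [Bool.and_eq_true, decide_eq_true_eq] at htab; exact htab.1.1.1
      have hnn : nearSteepB t.1.1 t.1.2 = false := by
        unfold inSteepTableB at htab; simp only [Bool.and_eq_true, Bool.not_eq_true'] at htab; exact htab.1.2
      exact hsteep t.1.1 t.1.2 hdm hnn (hchk t.1 ht.1) t.2.1 t.2.2.1 t.2.2.2 ht.2
    · rw [if_neg ht, if_neg ht]; simp
  -- (2) in-plane table terms dominate minus twice the (halved) plane charges
  have h2 : -(2 * ∑' t : (ℤ × ℤ) × (ℤ × ℤ × ℤ),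
      (if t.1 ∈ planeClasses R then
        classWt a z t.2.1 0 (3 * t.1.1, 3 * t.1.2) / 2 *
          ((planePieces t.1 (letterB s t.2.1)).map fun p =>
            ((p.s1 - p.s0 : ℚ) : ℝ) * tetStrain a s z U (planeCell s t.2.1 t.2.2.1 t.2.2.2 p) p.tet (planeVec a t.1) ^ 2).sum
      else 0)) ≤
      ∑' t : (ℤ × ℤ) × (ℤ × ℤ × ℤ),
        (if t.1 ∈ planeClasses R then farTerm a s z U (t.2, (t.2.1, t.2.2.1 + t.1.1, t.2.2.2 + t.1.2)) else 0) := by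
    rw [← tsum_mul_left, ← tsum_neg]
    refine Summable.tsum_le_tsum (fun t => ?_) (hsumCP.mul_left 2).neg hsumP
    by_cases ht : t.1 ∈ planeClasses R
    · rw [if_pos ht, if_pos ht]
      have htab := inPlaneTableB_of_mem ht
      unfold inPlaneTableB at htab
      simp only [Bool.and_eq_true, Bool.not_eq_true', decide_eq_false_iff_not, decide_eq_true_eq] at htab
      have h := hplane t.1 htab.1.1 htab.1.2 (hchkP t.1 ht) t.2.1 t.2.2.1 t.2.2.2
      have hre : 2 * (classWt a z t.2.1 0 (3 * t.1.1, 3 * t.1.2) / 2 *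
          ((planePieces t.1 (letterB s t.2.1)).map fun p =>
            ((p.s1 - p.s0 : ℚ) : ℝ) * tetStrain a s z U (planeCell s t.2.1 t.2.2.1 t.2.2.2 p) p.tet (planeVec a t.1) ^ 2).sum) =
          classWt a z t.2.1 0 (3 * t.1.1, 3 * t.1.2) *
          ((planePieces t.1 (letterB s t.2.1)).map fun p =>
            ((p.s1 - p.s0 : ℚ) : ℝ) * tetStrain a s z U (planeCell s t.2.1 t.2.2.1 t.2.2.2 p) p.tet (planeVec a t.1) ^ 2).sum := by
        ring
      rw [hre]; exact h
    · rw [if_neg ht, if_neg ht]; simp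
  -- (3) the certificate summed over cells
  have hsumHess : Summable (cellHess a s z U) := summable_of_hasFiniteSupport hfinH
  have hsumNN : Summable (cellNN s U) := summable_of_hasFiniteSupport hfinN
  have hsumNull : Summable (cellNull (C a (gap z 0)) a s z U) := summable_of_hasFiniteSupport hfinNull
  have hsumFC : Summable (cellFarCharge R η a s z U) := summable_of_hasFiniteSupport hfinFar
  have h3 : 0 ≤ ∑' ι : CIdx, cellHess a s z U ι - 2 * κ * ∑' ι : CIdx, cellNN s U ι -
      ∑' ι : CIdx, cellFarCharge R η a s z U ι := by
    have h : 0 ≤ ∑' ι : CIdx, (cellHess a s z U ι - 2 * κ * cellNN s U ι + cellNull (C a (gap z 0)) a s z U ι -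
        cellFarCharge R η a s z U ι) := tsum_nonneg fun ι => hCC a s z ha ha' hs hbox hpin U ι
    have heq : ∑' ι : CIdx, (cellHess a s z U ι - 2 * κ * cellNN s U ι + cellNull (C a (gap z 0)) a s z U ι -
        cellFarCharge R η a s z U ι) = ∑' ι : CIdx, cellHess a s z U ι - 2 * κ * ∑' ι : CIdx, cellNN s U ι +
        ∑' ι : CIdx, cellNull (C a (gap z 0)) a s z U ι - ∑' ι : CIdx, cellFarCharge R η a s z U ι := by
      rw [((hsumHess.sub (hsumNN.mul_left (2 * κ))).add hsumNull).tsum_sub hsumFC,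
        (hsumHess.sub (hsumNN.mul_left (2 * κ))).tsum_add hsumNull,
        hsumHess.tsum_sub (hsumNN.mul_left (2 * κ)), tsum_mul_left]
    rw [heq, hnull] at h
    linarith
  -- (4) combine
  rw [hregroup] at h3
  rw [hsplit]
  nlinarith [h1, h2, h3, htail]

/-- The registered v2 stub `stub_farNear`, now the assembly of the eight v3 stubs. -/
theorem stub_farNear :
    (∀ (a : ℝ) (s : ℤ → ℤ) (z : ℤ → ℝ), 47 / 50 ≤ a → a ≤ 1 → IsHaggSeq s → HeightBox a z → NullFactsAt a s z) →
      ∃ κ₁ : ℝ, 0 < κ₁ ∧ FarNearAt κ₁ :=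
  farNear_of (R := R₃) (K := Ktail) (η := ηpar) (κ := κcert) (C := Ccoef)
    (by unfold R₃; norm_num) (by unfold ηpar; norm_num) (by unfold Ktail R₃ κcert; norm_num)
    stub_allChecked stub_chainIdentity stub_planeChainIdentity stub_pairCharge stub_farCensus stub_farRegroup
    stub_farTail stub_cellCert

/-! ### The composition (kernel-checked, no `sorry`): stubs ⟹ the crux -/

/-- Pointwise split of the pair term into its near and far parts (`K(e)·0 = 0` on the diagonal). -/
theorem hessTerm_eq_near_add_far (a : ℝ) (s : ℤ → ℤ) (z : ℤ → ℝ) (U : Idx → E3) (xy : Idx × Idx) :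
    hessTerm a s z U xy = nearTerm a s z U xy + farTerm a s z U xy := by
  unfold hessTerm nearTerm farTerm
  by_cases h1 : xy.1 = xy.2
  · simp [h1]
  · by_cases h2 : NearPair s xy.1 xy.2 <;> simp [h1, h2]

/-- COMPOSITION WITH EXPLICIT HYPOTHESES: the six stub statements give the crux's inequality with `κ = κ₁`. -/
theorem composition
    (h₁ : ∀ (a : ℝ) (s : ℤ → ℤ) (z : ℤ → ℝ), 47 / 50 ≤ a → a ≤ 1 → IsHaggSeq s → HeightBox a z →
      SitesFacts a s z)
    (h₂ : ∀ (a : ℝ) (s : ℤ → ℤ) (z : ℤ → ℝ), 47 / 50 ≤ a → a ≤ 1 → IsHaggSeq s → HeightBox a z →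
      SitesFacts a s z → PairSumFacts a s z)
    (h₃ : ∀ (a : ℝ) (s : ℤ → ℤ) (z : ℤ → ℝ), 47 / 50 ≤ a → a ≤ 1 → IsHaggSeq s → HeightBox a z →
      SitesFacts a s z → NearCellFacts a s z)
    (h₄ : ∀ (a : ℝ) (s : ℤ → ℤ) (z : ℤ → ℝ), 47 / 50 ≤ a → a ≤ 1 → IsHaggSeq s → HeightBox a z →
      NullFactsAt a s z)
    (h₅ : ∀ (a : ℝ) (s : ℤ → ℤ) (z : ℤ → ℝ), 47 / 50 ≤ a → a ≤ 1 → IsHaggSeq s → HeightBox a z →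
      ForceBalanced a s z → GapsPinned z)
    (h₆ : (∀ (a : ℝ) (s : ℤ → ℤ) (z : ℤ → ℝ), 47 / 50 ≤ a → a ≤ 1 → IsHaggSeq s → HeightBox a z →
      NullFactsAt a s z) → ∃ κ₁ : ℝ, 0 < κ₁ ∧ FarNearAt κ₁) :
    ∃ κ : ℝ, 0 < κ ∧ ∀ (a : ℝ) (s : ℤ → ℤ) (z : ℤ → ℝ), 47 / 50 ≤ a → a ≤ 1 → IsHaggSeq s →
      HeightBox a z → ForceBalanced a s z →
      ∀ u : E3 → E3, (Function.support u).Finite → Function.support u ⊆ Sites a s z →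
        κ * nnForm a s z u ≤ hessForm a s z u / 2 := by
  obtain ⟨κ₁, hκ₁, hfar⟩ := h₆ h₄
  refine ⟨κ₁, hκ₁, ?_⟩
  intro a s z ha ha' hs hbox hfb u hu hsupp
  have hS : SitesFacts a s z := h₁ a s z ha ha' hs hbox
  obtain ⟨hinj, hrange, hsep, hnn, hnearp⟩ := hS
  have hP := h₂ a s z ha ha' hs hbox ⟨hinj, hrange, hsep, hnn, hnearp⟩ u hu hsupp
  obtain ⟨hsumH, hH, hsumN, hN⟩ := hP
  set U : Idx → E3 := u ∘ pos a s z with hUdef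
  -- `U` is finitely supported
  have hU : (Function.support U).Finite := by
    have hsub : Function.support U ⊆ pos a s z ⁻¹' Function.support u := by
      intro x hx
      simpa [hUdef, Function.mem_support] using hx
    refine Set.Finite.subset ?_ hsub
    exact hu.preimage (hinj.injOn.mono (Set.subset_univ _))
  obtain ⟨hfinH, hfinN, hsumNear, hsumNNC, hcellH, hcellN⟩ := h₃ a s z ha ha' hs hbox
    ⟨hinj, hrange, hsep, hnn, hnearp⟩ U hU
  have hpin : GapsPinned z := h₅ a s z ha ha' hs hbox hfb
  have key := hfar a s z ha ha' hs hbox hpin ⟨hinj, hrange, hsep, hnn, hnearp⟩ U hU hsumH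
  -- the far family is summable and `hessForm = Σ near + Σ far`
  have hsplit : ∀ xy, hessTerm a s z U xy = nearTerm a s z U xy + farTerm a s z U xy :=
    fun xy => hessTerm_eq_near_add_far a s z U xy
  have hsumFar : Summable (farTerm a s z U) := by
    have : farTerm a s z U = fun xy => hessTerm a s z U xy - nearTerm a s z U xy := by
      funext xy; rw [hsplit xy]; ring
    rw [this]
    exact hsumH.sub hsumNear
  have hHsplit : hessForm a s z u =
      2 * ∑' ι : CIdx, cellHess a s z U ι + ∑' xy : Idx × Idx, farTerm a s z U xy := by
    rw [hH, ← hcellH, ← (hsumNear.tsum_add hsumFar)]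
    exact tsum_congr hsplit
  -- the nearest-neighbour form is the combinatorial one
  have hNC : nnForm a s z u = 2 * ∑' ι : CIdx, cellNN s U ι := by
    rw [hN, ← hcellN]
    refine tsum_congr fun xy => ?_
    unfold nnTerm nnTermC
    by_cases hxy : xy.1 = xy.2
    · simp [hxy, hUdef]
    · have hiff : dist (pos a s z xy.1) (pos a s z xy.2) ≤ 11 / 10 ↔ NNPair s xy.1 xy.2 := by
        constructor
        · exact fun h => (hnn xy.1 xy.2).1 ⟨hxy, h⟩
        · exact fun h => ((hnn xy.1 xy.2).2 h).2
      by_cases hd : dist (pos a s z xy.1) (pos a s z xy.2) ≤ 11 / 10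
      · simp [hd, hiff.1 hd, hUdef]
      · have : ¬ NNPair s xy.1 xy.2 := fun h => hd (hiff.2 h)
        simp [hd, this]
  rw [hNC, hHsplit]
  exact key

/-- THE SKELETON THEOREM: the crux
`Summit.AtomisticToContinuum.Crystallization.Theses.DisclinationRation.UniformPolytypeStability`
concluded BY NAME (type literally the route decl) from the six DECLARED stubs through the sorry-free `composition`;
`sorry` lives only inside `stub_*`; this is the ONLY theorem of the file whose head is the crux name. -/
theorem UniformPolytypeStability_of :
    Summit.AtomisticToContinuum.Crystallization.Theses.DisclinationRation.UniformPolytypeStability :=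
  uniformPolytypeStability_iff.mpr
    (composition stub_sites stub_pairSum stub_nearCells stub_null stub_gapPinning stub_farNear)

end Summit.AtomisticToContinuum.Crystallization.Theorems.UniformPolytypeStabilityCells

end
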